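import Summits.QuantumFields.YangMills.Theorems.BalabanUVNodesN12FlatHndRecordLetters
import HarnessLib

/-!
# BalabanUVNodes ∕ N12 — ROOTED SPANNING FORESTS OF THE FINE TORUS FOR ANY ROOT SET (the `path` datum of dag-n12-w6's `B15Prop1AxialGaugeSectionOfForest` with its letters
# (F1) prefix∕orientation and (F2) roots DISCHARGED, by breadth-first search), the residual decomposition `V = S_forest + dξ` behind the onto letter, and the TRANSVERSALITY of the
# forest slice rooted at the constrained representatives to the locally-constant flat null space modulo the connectivity letter (C); the forest at the record's `𝐁_k(Z)`

Cell `pub-ymgap` (HUMAN RULINGS D-0062 ∕ D-0149), WIDTH SEAT `pub-ymgap-dag-n12-w3` g3 (node N12 = [B15]; key K1⁷ `stmt-QuantumFields-20542`, `--kind proof --supports … --as helper`;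
count-neutral).  THEOREMS ONLY (0 `def`, 0 `instance`, 0 `sorry`); consumed BY NAME: `T4Continuum.walkEnd_apply` ∕ `walkEnd_append`, `T4ReflectionCone.netDisp_replicate`, `Site.shift_unshift`,
this seat's `N12FlatHndRecordLetters.hcov_Bj` (p608348).  Companion (next file, `BalabanUVNodesN12ForestSlice`): (β)♭ at NODE 00's flat chart for the forest slice and the junction with
dag-n12-w6's criticality transfer `B15Prop1AxialGaugeSectionOfForest.hcritT_isCritOnFibre_of_forest` (p612182).

WHY (LOCATED-GAUGE, first hand [Balaban1985RegularSpaces] p. 79 (1.19), [Balaban1985Variational] p. 278 (4), p. 280 (16)–(18)).  Print fixes the residual gauge freedom (4)∕(1.14)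
`u(y) = 1, y ∈ 𝔅_k` of the variational problem by the axial gauge `Ax_k(𝔅_k, U₀)` of (1.19), which is BLOCK-HIERARCHICAL and acts on the AVERAGED configurations: «for
`x₀ ∈ Bʲ(x_j)`, `x_j ∈ Λ_j` … `x_n ∈ B(x_{n+1})` … `(R Ū′ⁿ)(Γ_{x_{n+1},x_n}) = 1`», `n = 0, …, j − 1`; its linearisation at the flat configuration is the `hierAxial` slice of this
seat's files 8–14 (`N12FlatHndHarmonicLetter.hnondeg_real_flat_hierAxial_Bj_allZ`).  dag-n12-w6's residual gauge-fixing MAP `σ` (p612182: (σ1)–(σ4) of the N12 criticality transfer)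
is instead the PATH-HOLONOMY gauge of a rooted forest of FINE bonds given by `path : Site P 0 → List (LStep P 0)`, with slice (F3) «`X ∈ S ↔ X = 0` on every path bond».  The two gauges
coincide for `k = 1` and differ for `k ≥ 2` (the level-`n ≥ 1` conditions of (1.19) constrain the averages `Q^{(n)}X`, not single fine bonds; a fine straightening of the hierarchical comb
is not a forest — the far half of every straightened coarse bond hangs from the next centre).  Both are honest gauges for the residual group (4); the per-base-field letters `hH` ∕ (β) ∕
`hcritT` of dag-n12-w1's `B15Prop1LinearisedKernelDictionary.hMin_atRecord_of_node00Letters` need ONE slice `S` serving all three, and for the forest slice all three are bookkeeping: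
(σ1)–(σ4) is p612182 given (F1)(F2)(F3); (β)♭ is §2 below + the companion; the onto half `V = S + {dξ : ξ|_roots = 0}` is §1.  This file supplies the forest ITSELF — for every nonempty
root set `R` of the torus (breadth-first search from `R`; the torus is connected), in particular for the constrained representatives `R(𝐁, k) = {embIter j c₋, embIter j c₊ : j ≤ k,
c ∈ bondsOf (𝐁 j)}` ((4): where the residual gauge transformations are `1`) — so that after it the N12 criticality transfer displays NO comb choice.

CONTENTS.  §1 rooted spanning forests of `T^{(j)}`: `exists_word_walkEnd_eq` (connectedness), `exists_bfsRank` (breadth-first rank from `R`), ★★ `exists_rootedForest` ((F2) `path r = []`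
on `R` ∧ (TREE) every `x ∉ R` hangs from a parent by its last step, oriented), ★ `forest_F1` ((F2)+(TREE) ⟹ dag-n12-w6's (F1) verbatim), ★ `exists_root_eq_of_forest` (a potential
constant along the forest equals a root value), ★★ `exists_residual_of_forest` (`X = −dξ` on the forest with `ξ|_R = 0`: the residual decomposition `V = S_forest + T_res`).
§2 ★★ `grad_eq_zero_of_forest_of_locConst` — TRANSVERSALITY of the forest slice rooted at `R(𝐁, k)` to the locally-constant flat null space, modulo the connectivity letter (C) only
(compare `N12FlatHierAxialHndDetSet.grad_eq_zero_of_hierAxial_of_locConst`: (Cov) is replaced by (TREE), and no `Q`-recursion enters).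
§3 ★ `exists_rootedForest_detSet` ((F1) ∧ (F2) ∧ (TREE) at `R(𝐁, k)` for any `𝐁` with a constrained bond), ★ `exists_rootedForest_Bj` (the record's `𝐁_k(Z)`, every `Z`: nonempty by
`hcov_Bj`).

HONEST FRAMING.  A fine-lattice TREE GAUGE (rooted spanning forest found by breadth-first search) for the residual group (4)∕(1.14), in place of print's block-hierarchical averaged
`Ax_k(𝔅_k, U₀)` of [Balaban1985RegularSpaces] (1.19) — print's choice serves the QUANTITATIVE regularity (19) of [Balaban1985Variational], which N12's qualitative junction does not
use; finite graph theory and linear algebra; no constants; nothing of Bałaban's estimates asserted; N12 NOT discharged; K1⁷ NOT closed; counts unmoved (typed 28∕28 · discharged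
5∕27); one finite 𝕋⁴ programme at fixed ε — R4 closes the conditional rung `BalabanLadder.UV` only; the Yang–Mills mass gap (Clay) is NOT proved by any of this; nothing continuum ∕
ℝ⁴ ∕ OS.
-/

noncomputable section

namespace Summit.QuantumFields.YangMills.BalabanUVNodes.N12RootedForest

open scoped BigOperators
open Literature.MathematicalPhysics.QuantumFieldTheory.Balaban1983to89
open T4Continuum
open B15DeterminingSets

variable {P : Params} {j : ℕ}

/-! ## §1 Rooted spanning forests of the torus `T^{(j)}` in the `path` currency -/

section Forest

/-- THE TORUS IS CONNECTED: every site is the end of a lattice walk from any other site (`(x_μ − r_μ) mod N` forward steps in each direction). [cite: Balaban1987RG1, (0.1) p.251 (the torus; bookkeeping)] -/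
theorem exists_word_walkEnd_eq (r x : Site P j) : ∃ w : List (Letter P.d), walkEnd r w = x := by
  classical
  suffices h : ∀ s : Finset (Fin P.d), ∃ w : List (Letter P.d), ∀ ν, walkEnd r w ν = if ν ∈ s then x ν else r ν by
    obtain ⟨w, hw⟩ := h Finset.univ
    exact ⟨w, funext fun ν => by rw [hw ν, if_pos (Finset.mem_univ ν)]⟩
  intro s
  refine Finset.induction_on s ⟨[], fun ν => ?_⟩ ?_
  · rw [if_neg (Finset.notMem_empty ν)]
    rfl
  · intro μ s hμ ih
    obtain ⟨w, hw⟩ := ih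
    refine ⟨w ++ List.replicate (x μ - r μ).val (μ, true), fun ν => ?_⟩
    rw [walkEnd_append, walkEnd_apply, hw ν, T4ReflectionCone.netDisp_replicate]
    by_cases hν : ν = μ
    · subst hν
      simp [hμ]
    · simp [hν, Ne.symm hν]

/-- **BREADTH-FIRST RANK FROM A NONEMPTY ROOT SET**: a rank `ρ` (the graph distance to `R`) such that every non-root site is one lattice step away from a site of smaller rank. [folklore] -/
theorem exists_bfsRank (R : Set (Site P j)) (hR : R.Nonempty) :
    ∃ ρ : Site P j → ℕ, ∀ x, x ∉ R → ∃ (x' : Site P j) (l : Letter P.d), ρ x' < ρ x ∧ walkEnd x' [l] = x := by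
  classical
  obtain ⟨r₀, hr₀⟩ := hR
  have hreach : ∀ x : Site P j, ∃ n, ∃ r ∈ R, ∃ w : List (Letter P.d), w.length = n ∧ walkEnd r w = x := fun x => by
    obtain ⟨w, hw⟩ := exists_word_walkEnd_eq r₀ x
    exact ⟨w.length, r₀, hr₀, w, rfl, hw⟩
  refine ⟨fun x => Nat.find (hreach x), fun x hx => ?_⟩
  obtain ⟨r, hr, w, hlen, hw⟩ := Nat.find_spec (hreach x)
  rcases w.eq_nil_or_concat with rfl | ⟨w', l, rfl⟩
  · have hrx : r = x := hw
    subst hrx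
    exact absurd hr hx
  · rw [List.concat_eq_append] at hlen hw
    refine ⟨walkEnd r w', l, ?_, by rw [← walkEnd_append]; exact hw⟩
    have h1 : Nat.find (hreach (walkEnd r w')) ≤ w'.length := Nat.find_min' _ ⟨r, hr, w', rfl, rfl⟩
    have h2 : (w' ++ [l]).length = Nat.find (hreach x) := hlen
    rw [List.length_append, List.length_singleton] at h2
    show Nat.find (hreach (walkEnd r w')) < Nat.find (hreach x)
    omega

/-- ★★ **A ROOTED SPANNING FOREST OF THE TORUS FOR ANY NONEMPTY ROOT SET `R`**, in the `path : Site → List (LStep)` currency of dag-n12-w6's `B15Prop1AxialGaugeSectionOfForest`: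
(F2) the roots have empty paths, and (TREE) every non-root `x` hangs from a parent `x′` by the last step of its path, the step's bond joining `x′` to `x` in the stated orientation
(breadth-first search from `R`). [folklore] -/
theorem exists_rootedForest (R : Set (Site P j)) (hR : R.Nonempty) :
    ∃ path : Site P j → List (LStep P j), (∀ r ∈ R, path r = []) ∧
      ∀ x, x ∉ R → ∃ (x' : Site P j) (s : LStep P j), path x = path x' ++ [s] ∧
        (s.fwd = true → s.bond.src = x' ∧ s.bond.tgt = x) ∧ (s.fwd = false → s.bond.src = x ∧ s.bond.tgt = x') := by
  classical
  obtain ⟨ρ, hρ⟩ := exists_bfsRank R hR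
  -- one oriented step from `x′` to `walkEnd x′ [l]`
  have hstep : ∀ (x' : Site P j) (l : Letter P.d), ∃ s : LStep P j,
      (s.fwd = true → s.bond.src = x' ∧ s.bond.tgt = walkEnd x' [l]) ∧ (s.fwd = false → s.bond.src = walkEnd x' [l] ∧ s.bond.tgt = x') := by
    rintro x' ⟨μ, b⟩
    cases b
    · exact ⟨⟨⟨x'.unshift μ, μ⟩, false⟩, fun h => absurd h Bool.false_ne_true, fun _ => ⟨rfl, Site.shift_unshift x' μ⟩⟩
    · exact ⟨⟨⟨x', μ⟩, true⟩, fun _ => ⟨rfl, rfl⟩, fun h => absurd h (by simp)⟩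
  -- a parent and a step for every non-root site
  have hpar : ∀ x : Site P j, ∃ (x' : Site P j) (s : LStep P j), x ∉ R → ρ x' < ρ x ∧
      (s.fwd = true → s.bond.src = x' ∧ s.bond.tgt = x) ∧ (s.fwd = false → s.bond.src = x ∧ s.bond.tgt = x') := by
    intro x
    by_cases hxR : x ∈ R
    · exact ⟨x, ⟨⟨x, ⟨0, P.hd⟩⟩, true⟩, fun h => absurd hxR h⟩
    · obtain ⟨x', l, hlt, hx⟩ := hρ x hxR
      obtain ⟨s, hs⟩ := hstep x' l
      subst hx
      exact ⟨x', s, fun _ => ⟨hlt, hs⟩⟩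
  choose par st hps using hpar
  -- the forest, layer by layer of the rank
  have hlayer : ∀ n : ℕ, ∃ path : Site P j → List (LStep P j),
      (∀ x, ρ x ≤ n → x ∉ R → ∃ (x' : Site P j) (s : LStep P j), ρ x' < ρ x ∧ path x = path x' ++ [s] ∧
        (s.fwd = true → s.bond.src = x' ∧ s.bond.tgt = x) ∧ (s.fwd = false → s.bond.src = x ∧ s.bond.tgt = x')) ∧
      (∀ x, (n < ρ x ∨ x ∈ R) → path x = []) := by
    intro n
    induction n with
    | zero =>
      refine ⟨fun _ => [], fun x hx hxR => ?_, fun _ _ => rfl⟩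
      obtain ⟨hlt, -⟩ := hps x hxR
      omega
    | succ n ih =>
      obtain ⟨path, htree, hnil⟩ := ih
      refine ⟨fun x => if ρ x = n + 1 ∧ x ∉ R then path (par x) ++ [st x] else path x, fun x hx hxR => ?_, fun x hx => ?_⟩
      · by_cases hρx : ρ x = n + 1
        · obtain ⟨hlt, hor⟩ := hps x hxR
          refine ⟨par x, st x, hlt, ?_, hor⟩
          have hp : ¬(ρ (par x) = n + 1 ∧ par x ∉ R) := fun h => by omega
          dsimp only
          rw [if_pos ⟨hρx, hxR⟩, if_neg hp]
        · obtain ⟨x', s, hlt, hpx, hor⟩ := htree x (by omega) hxR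
          refine ⟨x', s, hlt, ?_, hor⟩
          have h1 : ¬(ρ x = n + 1 ∧ x ∉ R) := fun h => hρx h.1
          have h2 : ¬(ρ x' = n + 1 ∧ x' ∉ R) := fun h => by omega
          dsimp only
          rw [if_neg h1, if_neg h2, hpx]
      · have h1 : ¬(ρ x = n + 1 ∧ x ∉ R) := by
          rintro ⟨h, h'⟩
          rcases hx with hx | hx
          · omega
          · exact h' hx
        dsimp only
        rw [if_neg h1]
        refine hnil x (hx.imp (fun h => by omega) id)
  obtain ⟨path, htree, hnil⟩ := hlayer (Finset.univ.sup ρ)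
  exact ⟨path, fun r hr => hnil r (Or.inr hr), fun x hxR => by
    obtain ⟨x', s, -, hpx, hor⟩ := htree x (Finset.le_sup (Finset.mem_univ x)) hxR
    exact ⟨x', s, hpx, hor⟩⟩

variable {R : Set (Site P j)} {path : Site P j → List (LStep P j)}

/-- ★ **(F2) + (TREE) ⟹ (F1)**: in a rooted forest every step of every path is the last step of the path of its far end, whose prefix is the path of its near end — the letter (F1)
PREFIX∕ORIENTATION of `B15Prop1AxialGaugeSectionOfForest.exists_gaugeSection_of_forest`, verbatim. [cite: Balaban1985RegularSpaces, (1.19) p.79 (the tree recursion; bookkeeping)] -/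
theorem forest_F1 (hroot : ∀ r ∈ R, path r = [])
    (htree : ∀ x, x ∉ R → ∃ (x' : Site P j) (s : LStep P j), path x = path x' ++ [s] ∧
      (s.fwd = true → s.bond.src = x' ∧ s.bond.tgt = x) ∧ (s.fwd = false → s.bond.src = x ∧ s.bond.tgt = x')) :
    ∀ x, ∀ s ∈ path x, ∃ x' x'' : Site P j, path x'' = path x' ++ [s] ∧
      (s.fwd = true → s.bond.src = x' ∧ s.bond.tgt = x'') ∧ (s.fwd = false → s.bond.src = x'' ∧ s.bond.tgt = x') := by
  intro x
  induction' hn : (path x).length using Nat.strong_induction_on with n ih generalizing x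
  intro s hs
  by_cases hxR : x ∈ R
  · rw [hroot x hxR] at hs
    simp at hs
  · obtain ⟨x', t, hpx, hor⟩ := htree x hxR
    rw [hpx, List.mem_append, List.mem_singleton] at hs
    rcases hs with hs | rfl
    · exact ih (path x').length (by rw [← hn, hpx, List.length_append, List.length_singleton]; omega) x' rfl s hs
    · exact ⟨x', x, hpx, hor⟩

/-- ★ **A POTENTIAL CONSTANT ALONG THE FOREST EQUALS A ROOT VALUE**: if `φ(b₊) = φ(b₋)` on every path bond then `φ x = φ r` for some root `r ∈ R` (the root of the tree of `x`).
[cite: Balaban1985RegularSpaces, (1.14) p.78, (1.19) p.79 (bookkeeping)] -/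
theorem exists_root_eq_of_forest
    (htree : ∀ x, x ∉ R → ∃ (x' : Site P j) (s : LStep P j), path x = path x' ++ [s] ∧
      (s.fwd = true → s.bond.src = x' ∧ s.bond.tgt = x) ∧ (s.fwd = false → s.bond.src = x ∧ s.bond.tgt = x'))
    {V : Type*} (φ : Site P j → V) (hφ : ∀ x, ∀ s ∈ path x, φ s.bond.tgt = φ s.bond.src) (x : Site P j) :
    ∃ r ∈ R, φ x = φ r := by
  induction' hn : (path x).length using Nat.strong_induction_on with n ih generalizing x
  by_cases hxR : x ∈ R
  · exact ⟨x, hxR, rfl⟩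
  · obtain ⟨x', t, hpx, hfwd, hbwd⟩ := htree x hxR
    have hxx' : φ x = φ x' := by
      have ht := hφ x t (by rw [hpx]; exact List.mem_append_right _ (List.mem_singleton_self t))
      cases h : t.fwd
      · obtain ⟨hs, htg⟩ := hbwd h
        rw [hs, htg] at ht
        exact ht.symm
      · obtain ⟨hs, htg⟩ := hfwd h
        rw [hs, htg] at ht
        exact ht
    obtain ⟨r, hr, hφr⟩ := ih (path x').length (by rw [← hn, hpx, List.length_append, List.length_singleton]; omega) x' rfl
    exact ⟨r, hr, hxx'.trans hφr⟩

/-- ★★ **THE RESIDUAL DECOMPOSITION `V = S_forest + T_res`** (the onto half of the slice): for every bond field `X` there is a site function `ξ` vanishing on the roots with `X + dξ = 0`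
on every path bond (`ξ(x) = −` the signed sum of `X` along `path x`), so `X + dξ` lies in the forest slice while `dξ` is a residual pure gauge ((4): `ξ = 0` on `R`).
[cite: Balaban1985Variational, (4) p.278, (16)–(18) p.280; Balaban1985RegularSpaces, (1.19) p.79] -/
theorem exists_residual_of_forest (hroot : ∀ r ∈ R, path r = [])
    (hF1 : ∀ x, ∀ s ∈ path x, ∃ x' x'' : Site P j, path x'' = path x' ++ [s] ∧
      (s.fwd = true → s.bond.src = x' ∧ s.bond.tgt = x'') ∧ (s.fwd = false → s.bond.src = x'' ∧ s.bond.tgt = x'))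
    {V : Type*} [AddCommGroup V] (X : PBond P j → V) :
    ∃ ξ : Site P j → V, (∀ r ∈ R, ξ r = 0) ∧ ∀ x, ∀ s ∈ path x, X s.bond + (ξ s.bond.tgt - ξ s.bond.src) = 0 := by
  refine ⟨fun x => -((path x).map fun s => if s.fwd then X s.bond else -X s.bond).sum, fun r hr => by simp [hroot r hr], ?_⟩
  intro x s hs
  obtain ⟨x', x'', hp, hfwd, hbwd⟩ := hF1 x s hs
  have hsum : ((path x'').map fun s => if s.fwd then X s.bond else -X s.bond).sum =
      ((path x').map fun s => if s.fwd then X s.bond else -X s.bond).sum + (if s.fwd then X s.bond else -X s.bond) := by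
    rw [hp, List.map_append, List.sum_append, List.map_singleton, List.sum_singleton]
  beta_reduce
  cases h : s.fwd
  · obtain ⟨hs, ht⟩ := hbwd h
    rw [hs, ht, hsum, h]
    simp only [Bool.false_eq_true, if_false]
    abel
  · obtain ⟨hs, ht⟩ := hfwd h
    rw [hs, ht, hsum, h]
    simp only [if_true]
    abel

end Forest

/-! ## §2 The forest slice rooted at the constrained representatives is transversal to the locally-constant flat null space (modulo (C)) -/

section Transversal

variable {V : Type*}

/-- ★★ **TRANSVERSALITY OF THE FOREST SLICE, MODULO THE CONNECTIVITY LETTER (C).**  Roots: the constrained representatives `R(𝐁, k) = {embIter j c₋, embIter j c₊ : j ≤ k, c ∈ bondsOf (𝐁 j)}`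
((4)∕(1.14): where the residual gauge transformations are `1`).  If every non-root hangs in the forest (TREE), a potential `φ` that is constant along every constrained bond at the centres
(`hconst`) and constant along every path bond (`hax`: its gradient lies in the forest slice) is constant: `dφ = 0` — every site carries the value of its root, a root value is a constrained
source value (`hconst` for the far ends), and (C) identifies all of those. [cite: Balaban1985Variational, (4) p.278; Balaban1985RegularSpaces, (1.14) p.78, (1.19) p.79; Balaban1988Convergent, (2.2) p.255, (2.13) pp.256-257] -/
theorem grad_eq_zero_of_forest_of_locConst [AddCommGroup V] (𝔹 : DetSet P) (k : ℕ) {path : Site P 0 → List (LStep P 0)}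
    (htree : ∀ x : Site P 0, x ∉ {z : Site P 0 | ∃ j, j ≤ k ∧ ∃ c ∈ bondsOf (𝔹 j), (z = embIter j c.src ∨ z = embIter j c.tgt)} →
      ∃ (x' : Site P 0) (s : LStep P 0), path x = path x' ++ [s] ∧
        (s.fwd = true → s.bond.src = x' ∧ s.bond.tgt = x) ∧ (s.fwd = false → s.bond.src = x ∧ s.bond.tgt = x'))
    (hconn : ∀ ψ : Site P 0 → V, (∀ j, j ≤ k → ∀ c ∈ bondsOf (𝔹 j), ψ (embIter j c.tgt) = ψ (embIter j c.src)) →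
      ∀ j j', j ≤ k → j' ≤ k → ∀ c ∈ bondsOf (𝔹 j), ∀ c' ∈ bondsOf (𝔹 j'), ψ (embIter j c.src) = ψ (embIter j' c'.src))
    (φ : Site P 0 → V) (hconst : ∀ j, j ≤ k → ∀ c ∈ bondsOf (𝔹 j), φ (embIter j c.tgt) = φ (embIter j c.src))
    (hax : ∀ x, ∀ s ∈ path x, φ s.bond.tgt = φ s.bond.src) :
    ∀ b : PBond P 0, φ b.tgt - φ b.src = 0 := by
  have hsrc : ∀ x : Site P 0, ∃ j, j ≤ k ∧ ∃ c ∈ bondsOf (𝔹 j), φ x = φ (embIter j c.src) := fun x => by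
    obtain ⟨r, ⟨j, hj, c, hc, hrc⟩, hφ⟩ := exists_root_eq_of_forest htree φ hax x
    refine ⟨j, hj, c, hc, ?_⟩
    rcases hrc with rfl | rfl
    · exact hφ
    · exact hφ.trans (hconst j hj c hc)
  intro b
  obtain ⟨j, hj, c, hc, ht⟩ := hsrc b.tgt
  obtain ⟨j', hj', c', hc', hs⟩ := hsrc b.src
  rw [ht, hs, sub_eq_zero]
  exact hconn φ hconst j j' hj hj' c hc c' hc'

end Transversal

/-! ## §3 The rooted forest at a determining set and at the record's `𝐁_k(Z)` -/

section Record

open Literature.MathematicalPhysics.QuantumFieldTheory.Balaban1983to89.B14.Eq213DetSet (Bj)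
open Literature.MathematicalPhysics.QuantumFieldTheory.Balaban1983to89.B14.Eq213MaximalDomains (side)
open B5Eq118OneStroke (iterBlockOf)

/-- ★ **THE ROOTED FOREST AT A DETERMINING SET**: for `𝐁` read up to level `k` with at least one constrained bond, a rooted spanning forest of `T_η` with (F1) PREFIX∕ORIENTATION and (F2) ROOTS at
the constrained representatives — the two letters of `B15Prop1AxialGaugeSectionOfForest.exists_gaugeSection_of_forest`, verbatim — and (TREE) every other site hanging in it.
[cite: Balaban1985Variational, (4) p.278, (16)–(18) p.280; Balaban1985RegularSpaces, (1.14) p.78, (1.19) p.79; Balaban1988Convergent, (2.2) p.255] -/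
theorem exists_rootedForest_detSet (𝔹 : DetSet P) (k : ℕ) (hne : ∃ j, j ≤ k ∧ ∃ c, c ∈ bondsOf (𝔹 j)) :
    ∃ path : Site P 0 → List (LStep P 0),
      (∀ x, ∀ s ∈ path x, ∃ x' x'' : Site P 0, path x'' = path x' ++ [s] ∧
        (s.fwd = true → s.bond.src = x' ∧ s.bond.tgt = x'') ∧ (s.fwd = false → s.bond.src = x'' ∧ s.bond.tgt = x')) ∧
      (∀ j, j ≤ k → ∀ c ∈ bondsOf (𝔹 j), path (embIter j c.src) = [] ∧ path (embIter j c.tgt) = []) ∧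
      (∀ x : Site P 0, x ∉ {z : Site P 0 | ∃ j, j ≤ k ∧ ∃ c ∈ bondsOf (𝔹 j), (z = embIter j c.src ∨ z = embIter j c.tgt)} →
        ∃ (x' : Site P 0) (s : LStep P 0), path x = path x' ++ [s] ∧
          (s.fwd = true → s.bond.src = x' ∧ s.bond.tgt = x) ∧ (s.fwd = false → s.bond.src = x ∧ s.bond.tgt = x')) := by
  obtain ⟨j, hj, c, hc⟩ := hne
  obtain ⟨path, hroot, htree⟩ := exists_rootedForest
    {z : Site P 0 | ∃ j, j ≤ k ∧ ∃ c ∈ bondsOf (𝔹 j), (z = embIter j c.src ∨ z = embIter j c.tgt)} ⟨embIter j c.src, j, hj, c, hc, Or.inl rfl⟩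
  exact ⟨path, forest_F1 hroot htree, fun j hj c hc => ⟨hroot _ ⟨j, hj, c, hc, Or.inl rfl⟩, hroot _ ⟨j, hj, c, hc, Or.inr rfl⟩⟩, htree⟩

/-- ★ **THE ROOTED FOREST AT THE RECORD's `𝐁_k(Z)`** (nonempty root set by the coverage letter `N12FlatHndRecordLetters.hcov_Bj`: the block tower of any site meets a member).
[cite: Balaban1988Convergent, (2.2) p.255, (2.13) pp.256-257; Balaban1985Variational, (4) p.278] -/
theorem exists_rootedForest_Bj {k M₁ : ℕ} {Z : Set (Site P 0)} (hk : k ≤ P.m + P.K) (hk1 : 1 ≤ k) (hM : 1 ≤ M₁) (hdiv : side P.L M₁ k ∣ P.sitesPerDir 0) :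
    ∃ path : Site P 0 → List (LStep P 0),
      (∀ x, ∀ s ∈ path x, ∃ x' x'' : Site P 0, path x'' = path x' ++ [s] ∧
        (s.fwd = true → s.bond.src = x' ∧ s.bond.tgt = x'') ∧ (s.fwd = false → s.bond.src = x'' ∧ s.bond.tgt = x')) ∧
      (∀ j, j ≤ k → ∀ c ∈ bondsOf ((Bj M₁ Z k : DetSet P) j), path (embIter j c.src) = [] ∧ path (embIter j c.tgt) = []) ∧
      (∀ x : Site P 0, x ∉ {z : Site P 0 | ∃ j, j ≤ k ∧ ∃ c ∈ bondsOf ((Bj M₁ Z k : DetSet P) j), (z = embIter j c.src ∨ z = embIter j c.tgt)} →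
        ∃ (x' : Site P 0) (s : LStep P 0), path x = path x' ++ [s] ∧
          (s.fwd = true → s.bond.src = x' ∧ s.bond.tgt = x) ∧ (s.fwd = false → s.bond.src = x ∧ s.bond.tgt = x')) := by
  obtain ⟨j, hj, hy⟩ := N12FlatHndRecordLetters.hcov_Bj hM hk1 hk hdiv (default : Site P 0)
  exact exists_rootedForest_detSet (Bj M₁ Z k) k ⟨j, hj, ⟨iterBlockOf j default, ⟨0, P.hd⟩⟩, Or.inl hy⟩

end Record

end Summit.QuantumFields.YangMills.BalabanUVNodes.N12RootedForest

end
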